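import Summits.CriticalPhenomena.PercolationContinuityZ3.Theorems.PercNearOneGluingNoHeavyLowerTailStarSetClassForestChampion
import Summits.CriticalPhenomena.PercolationContinuityZ3.Theorems.PercNearOneGluingNoHeavyLowerTailStarSetPendantForest
import HarnessLib

/-!
# `NoHeavyLowerTail` (stmt-CriticalPhenomena-4575) — observer sets of ONE-port pendants and TWO-port star CLASS forests, level `j ≤ 2`

Support file (prover `prim-gen-swap` gen 8; `--supports stmt-CriticalPhenomena-4575`).  No definitions, no named facts, no sorries.

The class-forest analogue of …StarSetPendantForest: `StarSet.setCS_twoPortStarClassForest_levelTwo_champion` (parallel two-port stars allowed,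
leaf-peeling order on the CLASSES) plus relay-pendant members, stripped one by one with `CutObserver.setCS_of_pendantMember`
(`StarSet.lightness_eq_off_pendant`).

* `StarSet.setCS_pendants_twoPortStarClassForest_champion` — `CS_w(T ∪ S, c)` for any finset `T` of relay-pendants and any two-port star
  class forest `S`, `c` a champion (induction on `T`).
* `StarSet.cil_pendants_twoPortStarClassForest_champion` — **CIL_j (`j ≤ 2`, all `|A|`) at every observer `o ∉ A` each of whose
  positive-weight non-relay neighbours is, off `o`, either a relay-pendant or a two-port pendant star, the two-port ones grouped into parallel
  classes whose class graph is a forest in a leaf-peeling order (= port multigraph without cycles of length `≥ 3`); witness ANY `H`-champion.**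
-/

noncomputable section

namespace Summit.CriticalPhenomena.PercolationContinuityZ3.Theorems

open MeasureTheory Set Literature.Probability.LatticeModels Literature.Probability.Percolation
open scoped Classical BigOperators

variable {n : ℕ}

namespace StarSet

open CutObserver KNPreFKG Hyperedge in
/-- **OES for relay-pendants plus a two-port star forest, champion witness.**  `T` a finset of relay-pendants (`t ∉ A`, only positive pair to
`z t ∈ A`), `S = {s i}` a two-port star class forest as in `setCS_twoPortStarClassForest_levelTwo_champion`, `T` and `S` disjoint, `c` a
champion of `A`, `j ≤ 2`.  Then `CS_w(T ∪ S, c)`. [cite: VandenbergHaggstromKahn2005, Thm. 1.5 (p. 7)] -/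
theorem setCS_pendants_twoPortStarClassForest_champion (A : Finset (Fin n)) (c : Fin n) (j : ℕ) (hj : j ≤ 2) (hcA : c ∈ A)
    {m M : ℕ} (s p p' : Fin m → Fin n) (cls : Fin m → Fin M) (P P' : Fin M → Fin n) (hP : ∀ i, p i = P (cls i))
    (hP' : ∀ i, p' i = P' (cls i)) (z : Fin n → Fin n) (hs : Function.Injective s) (hsA : ∀ i, s i ∉ A)
    (hpA : ∀ i, p i ∈ A) (hp'A : ∀ i, p' i ∈ A) (hpp' : ∀ i, p i ≠ p' i) (hforest : ∀ K I, K < I → P' K ≠ P I ∧ P' K ≠ P' I)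
    (T : Finset (Fin n)) :
    ∀ (w : Sym2 (Fin n) → unitInterval),
      (∀ t ∈ T, t ∉ A ∧ z t ∈ A ∧ (∀ i, t ≠ s i) ∧ ∀ u : Fin n, u ≠ t → u ≠ z t → w s(t, u) = 0) →
      (∀ i (u : Fin n), u ≠ s i → u ≠ p i → u ≠ p' i → w s(s i, u) = 0) →
      (∀ a ∈ A, (prodBernoulli w).real {ω : BondConfig (Fin n) | (A.filter fun x => ω ∈ openConn a x).card ≤ j} ≤
        (prodBernoulli w).real {ω : BondConfig (Fin n) | (A.filter fun x => ω ∈ openConn c x).card ≤ j}) →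
      (prodBernoulli w).real {ω : BondConfig (Fin n) | (∀ x ∈ T ∪ Finset.univ.image s, ω ∉ openConn c x) ∧
          1 ≤ (A.filter fun a => ∃ x ∈ T ∪ Finset.univ.image s, ω ∈ openConn x a).card ∧
          (A.filter fun a => ∃ x ∈ T ∪ Finset.univ.image s, ω ∈ openConn x a).card ≤ j} ≤
        (prodBernoulli w).real {ω : BondConfig (Fin n) | (∀ x ∈ T ∪ Finset.univ.image s, ω ∉ openConn c x) ∧
          (A.filter fun a => ω ∈ openConn c a).card ≤ j} := by
  induction T using Finset.induction_on with
  | empty =>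
    intro w _ hobs hchamp
    rw [Finset.empty_union]
    exact setCS_twoPortStarClassForest_levelTwo_champion A c j hj hcA P P' hforest m w s p p' cls hP hP' hs hsA hpA hp'A hpp' hobs hchamp
  | insert t T₀ ht ih =>
    intro w hT hobs hchamp
    obtain ⟨htA, hztA, hts, hiso⟩ := hT t (Finset.mem_insert_self t T₀)
    have hzt : z t ≠ t := fun h => htA (h ▸ hztA)
    have hct : c ≠ t := fun h => htA (h ▸ hcA)
    set B : Finset (Fin n) := insert t T₀ ∪ Finset.univ.image s with hB
    have htB : t ∈ B := Finset.mem_union_left _ (Finset.mem_insert_self t T₀)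
    set w' : Sym2 (Fin n) → unitInterval := fun f => if f ∈ {f : Sym2 (Fin n) | t ∉ f} then w f else 0 with hw'
    -- lightnesses of relays are unchanged
    have hlight : ∀ x ∈ A, ∀ d ∈ A, d ≠ z t →
        (prodBernoulli w).real {ω : BondConfig (Fin n) | (A.filter fun a => ω ∈ openConn x a).card ≤ j} =
          (prodBernoulli w').real {ω : BondConfig (Fin n) | (A.filter fun a => ω ∈ openConn x a).card ≤ j} :=
      fun x hx d hd hdz => lightness_eq_off_pendant w A t (z t) d x j htA hzt hd hdz hx hiso
    have hchamp' : ∀ a ∈ A, (prodBernoulli w').real {ω : BondConfig (Fin n) | (A.filter fun x => ω ∈ openConn a x).card ≤ j} ≤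
        (prodBernoulli w').real {ω : BondConfig (Fin n) | (A.filter fun x => ω ∈ openConn c x).card ≤ j} := by
      intro a ha
      by_cases hac : a = c
      · rw [hac]
      -- a witness `d ∈ A` off `z t`: one of `a`, `c`
      obtain ⟨d, hd, hdz⟩ : ∃ d ∈ A, d ≠ z t := by
        by_cases haz : a = z t
        · exact ⟨c, hcA, fun h => hac (haz.trans h.symm)⟩
        · exact ⟨a, ha, haz⟩
      rw [← hlight a ha d hd hdz, ← hlight c hcA d hd hdz]
      exact hchamp a ha
    have hw'_off : ∀ y u : Fin n, y ≠ t → u ≠ t → w' s(y, u) = w s(y, u) := by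
      intro y u hy hu
      have hf : t ∉ s(y, u) := by
        intro h
        rcases Sym2.mem_iff.1 h with h | h
        · exact hy h.symm
        · exact hu h.symm
      simp only [hw', mem_setOf_eq, hf, not_false_eq_true, if_true]
    have hw'_t : ∀ y : Fin n, w' s(y, t) = 0 := by
      intro y
      have : ¬ (t ∉ s(y, t)) := fun h => h (Sym2.mem_mk_right _ _)
      simp only [hw', mem_setOf_eq, this, if_false]
    -- the rest of the set in the graph off `t`
    have hrest := ih w'
      (fun t' ht' => by
        obtain ⟨h1, h2, h3, h4⟩ := hT t' (Finset.mem_insert_of_mem ht')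
        have htt' : t' ≠ t := fun h => ht (h ▸ ht')
        refine ⟨h1, h2, h3, fun u hu huz => ?_⟩
        by_cases hut : u = t
        · rw [hut]; exact hw'_t t'
        · rw [hw'_off t' u htt' hut]; exact h4 u hu huz)
      (fun i u hu hup hup' => by
        by_cases hut : u = t
        · rw [hut]; exact hw'_t _
        · rw [hw'_off _ u (fun h => hts i h.symm) hut]; exact hobs i u hu hup hup')
      hchamp'
    have hBerase : B.erase t = T₀ ∪ Finset.univ.image s := by
      ext x
      rw [Finset.mem_erase, hB, Finset.mem_union, Finset.mem_union, Finset.mem_insert]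
      constructor
      · rintro ⟨hne, (h | h) | h⟩
        · exact absurd h hne
        · exact Or.inl h
        · exact Or.inr h
      · rintro (h | h)
        · exact ⟨fun hx => ht (hx ▸ h), Or.inl (Or.inr h)⟩
        · refine ⟨fun hx => ?_, Or.inr h⟩
          obtain ⟨i, -, hi⟩ := Finset.mem_image.1 h
          exact hts i (hx ▸ hi.symm)
    rw [← hBerase] at hrest
    have hdom : (prodBernoulli w').real {ω : BondConfig (Fin n) | (A.filter fun a => ω ∈ openConn (z t) a).card ≤ j} ≤
        (prodBernoulli w').real {ω : BondConfig (Fin n) | (A.filter fun a => ω ∈ openConn c a).card ≤ j} := hchamp' (z t) hztA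
    exact setCS_of_pendantMember w A B c t (z t) j htB htA hzt hct hiso hdom hrest

open CutObserver in
/-- **CIL at level `j ≤ 2`: Steiner neighbours that are relay-pendants or two-port pendant stars (CLASS-forest port multigraph), any
`H`-champion.**  `o ∉ A`; every positive-weight non-relay neighbour of `o` is, off `o`, either one of the two-port stars `s i` (ports
`p i ≠ p' i ∈ A`, grouped into parallel classes `cls i` with class ports `Pc, P'c` in a leaf-peeling order `K < I → P'c K ∉ {Pc I, P'c I}`) or
a relay-pendant `t ∈ P` (only positive pair off `o` to `z t ∈ A`); `q ∈ A` an `H`-champion.  Then `μ(1 ≤ |π(o)| ≤ j) ≤ μ(|π(q)| ≤ j)`. [cite: VandenbergHaggstromKahn2005, Thm. 1.5 (p. 7); KozmaNitzan2024, Thm. 4 (pp. 13–14)] -/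
theorem cil_pendants_twoPortStarClassForest_champion {Ms M : ℕ} (w : Sym2 (Fin n) → unitInterval) (A : Finset (Fin n)) (o q : Fin n)
    (s p p' : Fin Ms → Fin n) (cls : Fin Ms → Fin M) (Pc P'c : Fin M → Fin n) (hPc : ∀ i, p i = Pc (cls i)) (hP'c : ∀ i, p' i = P'c (cls i))
    (P : Finset (Fin n)) (z : Fin n → Fin n) (j : ℕ) (hj : j ≤ 2) (hoA : o ∉ A) (hqA : q ∈ A)
    (hs : Function.Injective s) (hso : ∀ i, s i ≠ o) (hsA : ∀ i, s i ∉ A) (hpA : ∀ i, p i ∈ A) (hp'A : ∀ i, p' i ∈ A)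
    (hpp' : ∀ i, p i ≠ p' i) (hforest : ∀ K I, K < I → P'c K ≠ Pc I ∧ P'c K ≠ P'c I)
    (hP : ∀ t ∈ P, t ≠ o ∧ t ∉ A ∧ z t ∈ A ∧ (∀ i, t ≠ s i) ∧ ∀ u : Fin n, u ≠ t → u ≠ o → u ≠ z t → w s(t, u) = 0)
    (hnbr : ∀ y : Fin n, y ≠ o → y ∉ A → w s(o, y) ≠ 0 → y ∈ P ∨ ∃ i, y = s i)
    (hobs : ∀ i (u : Fin n), u ≠ s i → u ≠ o → u ≠ p i → u ≠ p' i → w s(s i, u) = 0)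
    (hchamp : ∀ a ∈ A,
      (prodBernoulli w).real {ω : BondConfig (Fin n) |
          (A.filter fun x => (openGraph (ω ∩ {e | o ∉ e})).Reachable a x).card ≤ j} ≤
        (prodBernoulli w).real {ω : BondConfig (Fin n) |
          (A.filter fun x => (openGraph (ω ∩ {e | o ∉ e})).Reachable q x).card ≤ j}) :
    (prodBernoulli w).real {ω : BondConfig (Fin n) |
        1 ≤ (A.filter fun x => ω ∈ openConn o x).card ∧ (A.filter fun x => ω ∈ openConn o x).card ≤ j} ≤
      (prodBernoulli w).real {ω : BondConfig (Fin n) | (A.filter fun x => ω ∈ openConn q x).card ≤ j} := by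
  have hqo : q ≠ o := fun h => hoA (h ▸ hqA)
  refine cil_of_starStability w A o q j hoA hqo fun B hBne hB => ?_
  set u : Sym2 (Fin n) → unitInterval := fun e => if e ∈ {e : Sym2 (Fin n) | o ∉ e} then w e else 0 with hu
  have hmem : ∀ y ∈ B, y ≠ o ∧ y ∉ A ∧ w s(o, y) ≠ 0 := by
    intro y hy
    obtain ⟨hyo, hwy, hlt⟩ := hB y hy
    refine ⟨hyo, fun hyA => ?_, hwy⟩
    exact absurd (hchamp y hyA) (not_le.2 hlt)
  have e1 : ∀ x : Fin n, {ω : BondConfig (Fin n) |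
        (A.filter fun a => (openGraph (ω ∩ {e | o ∉ e})).Reachable x a).card ≤ j} =
      {ω : BondConfig (Fin n) | ω ∩ {e | o ∉ e} ∈
        {ξ : BondConfig (Fin n) | (A.filter fun a => ξ ∈ openConn x a).card ≤ j}} := by
    intro x; ext ω; simp only [mem_setOf_eq, filter_avoid_eq]
  have hdomH : ∀ x ∈ A, (prodBernoulli u).real {ξ : BondConfig (Fin n) | (A.filter fun a => ξ ∈ openConn x a).card ≤ j} ≤
      (prodBernoulli u).real {ξ : BondConfig (Fin n) | (A.filter fun a => ξ ∈ openConn q a).card ≤ j} := by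
    intro x hx
    have h := hchamp x hx
    rw [e1 x, e1 q, measureReal_preimage_avoid, measureReal_preimage_avoid] at h
    exact h
  have e2 : {ω : BondConfig (Fin n) |
        (∀ y ∈ B, ¬ (openGraph (ω ∩ {e | o ∉ e})).Reachable q y) ∧
          1 ≤ (A.filter fun a => ∃ y ∈ B, (openGraph (ω ∩ {e | o ∉ e})).Reachable y a).card ∧
          (A.filter fun a => ∃ y ∈ B, (openGraph (ω ∩ {e | o ∉ e})).Reachable y a).card ≤ j} =
      {ω : BondConfig (Fin n) | ω ∩ {e | o ∉ e} ∈
        {ξ : BondConfig (Fin n) | (∀ x ∈ B, ξ ∉ openConn q x) ∧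
          1 ≤ (A.filter fun a => ∃ x ∈ B, ξ ∈ openConn x a).card ∧
          (A.filter fun a => ∃ x ∈ B, ξ ∈ openConn x a).card ≤ j}} := by
    ext ω; simp only [mem_setOf_eq, filter_avoid_exists_eq]; exact Iff.rfl
  have e3 : {ω : BondConfig (Fin n) |
        (∀ y ∈ B, ¬ (openGraph (ω ∩ {e | o ∉ e})).Reachable q y) ∧
          (A.filter fun a => (openGraph (ω ∩ {e | o ∉ e})).Reachable q a).card ≤ j} =
      {ω : BondConfig (Fin n) | ω ∩ {e | o ∉ e} ∈
        {ξ : BondConfig (Fin n) | (∀ x ∈ B, ξ ∉ openConn q x) ∧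
          (A.filter fun a => ξ ∈ openConn q a).card ≤ j}} := by
    ext ω; simp only [mem_setOf_eq, filter_avoid_eq]; exact Iff.rfl
  rw [e2, e3, measureReal_preimage_avoid, measureReal_preimage_avoid]
  have hu_oy : ∀ y v : Fin n, v = o → u s(y, v) = 0 := by
    intro y v hv
    simp only [hu, mem_setOf_eq]
    rw [if_neg (fun h => h (hv ▸ Sym2.mem_mk_right y v))]
  have hu_off : ∀ y v : Fin n, y ≠ o → v ≠ o → u s(y, v) = w s(y, v) := by
    intro y v hy hv
    simp only [hu, mem_setOf_eq]
    rw [if_pos]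
    intro h
    rcases Sym2.mem_iff.1 h with h | h
    · exact hy h.symm
    · exact hv h.symm
  -- the stars in `B`, with the inherited leaf-peeling order, and the pendants in `B`
  set I : Finset (Fin Ms) := Finset.univ.filter fun i => s i ∈ B with hI
  set emb := I.orderEmbOfFin rfl with hemb
  set s' : Fin I.card → Fin n := fun k => s (emb k) with hs'
  set T : Finset (Fin n) := B.filter fun y => y ∈ P with hT
  have hembI : ∀ k, emb k ∈ I := fun k => Finset.orderEmbOfFin_mem I rfl k
  have hs'B : ∀ k, s' k ∈ B := fun k => (Finset.mem_filter.1 (hembI k)).2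
  have hs'inj : Function.Injective s' := fun k k' h => emb.injective (hs h)
  have hTS : T ∪ Finset.univ.image s' = B := by
    ext y
    rw [Finset.mem_union, hT, Finset.mem_filter, Finset.mem_image]
    constructor
    · rintro (⟨hy, -⟩ | ⟨k, -, rfl⟩)
      · exact hy
      · exact hs'B k
    · intro hy
      obtain ⟨hyo, hyA, hwy⟩ := hmem y hy
      rcases hnbr y hyo hyA hwy with hyP | ⟨i, rfl⟩
      · exact Or.inl ⟨hy, hyP⟩
      · have hiI : i ∈ I := Finset.mem_filter.2 ⟨Finset.mem_univ _, hy⟩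
        have hrange := Finset.range_orderEmbOfFin I rfl
        have hi' : i ∈ Set.range emb := by rw [hemb, hrange]; exact hiI
        obtain ⟨k, hk⟩ := hi'
        exact Or.inr ⟨k, Finset.mem_univ _, by simp only [hs', hk]⟩
  have h := setCS_pendants_twoPortStarClassForest_champion A q j hj hqA s' (fun k => p (emb k)) (fun k => p' (emb k))
    (fun k => cls (emb k)) Pc P'c (fun k => hPc _) (fun k => hP'c _) z hs'inj
    (fun k => hsA _) (fun k => hpA _) (fun k => hp'A _) (fun k => hpp' _) hforest T u
    (fun t ht => by
      obtain ⟨htB, htP⟩ := Finset.mem_filter.1 ht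
      obtain ⟨hto, htA, hztA, hts, hiso⟩ := hP t htP
      refine ⟨htA, hztA, fun k => hts _, fun v hv hvz => ?_⟩
      by_cases hvo : v = o
      · exact hu_oy t v hvo
      · rw [hu_off t v hto hvo]; exact hiso v hv hvo hvz)
    (fun k v hv hvp hvp' => by
      by_cases hvo : v = o
      · exact hu_oy _ v hvo
      · rw [hs', hu_off _ v (hso _) hvo]
        exact hobs (emb k) v hv hvo hvp hvp')
    hdomH
  rw [hTS] at h
  exact h

end StarSet

end Summit.CriticalPhenomena.PercolationContinuityZ3.Theorems

end
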